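import Summits.PneNP.PneNP.Theses.RootDecompLinearSpace
import Literature.Computability.Complexity.SpaceProofs

/-!
# `RootDecompLinearSpace.ShallowTop` (stmt-PneNP-31866) — the top of the space-footprint dial is decided

Node N37 of the decomp-pnenp root-decomposition cell (route `route-PneNP-RootDecompLinearSpace`,
lens-4 g10 «LinearSpaceLift») cuts the root on the space-footprint dial `σ ↦ «P ⊆ DSPACE(n^σ)»` at
`σ = 1`.  The residual column at the TOP of the dial (`σ = ∞`) is a THEOREM: «NP ⊆ P → P ⊆ PSPACE»
holds outright because `P ⊆ PSPACE` is the tree theorem `P_subset_PSPACE_holds` — the calibrated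
degenerate end of the dial (its attacked partner `TransferTop` is ≡ S).  Port of the lens / writer-pack
kernel `shallowTop_holds` (HOME/decomp-pnenp-lens-4/LinearSpaceLift.lean sha256 d9ca87cc…).  0 sorry.
-/

namespace Summit.PneNP.PneNP.Theorems

/-- The top of the space-footprint dial (stmt-PneNP-31866, `ShallowTop`): «NP ⊆ P → P ⊆ PSPACE», by
the tree theorem `P_subset_PSPACE_holds` (the hypothesis is not used).  Port of the lens-4 g10 kernel
`shallowTop_holds` (decomp-pnenp cell, 2026-08-30). -/
theorem shallowTop_proof :
    Summit.PneNP.PneNP.Theses.RootDecompLinearSpace.ShallowTop := by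
  unfold Summit.PneNP.PneNP.Theses.RootDecompLinearSpace.ShallowTop
  intro _
  exact Literature.Computability.Complexity.P_subset_PSPACE_holds

end Summit.PneNP.PneNP.Theorems
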